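import Summits.Ventures.PercRepro.Night2T3Absorb
import Summits.Ventures.PercRepro.Night2T3Sizes
import Summits.Ventures.PercRepro.Night2T3Tangent
import Summits.Ventures.PercRepro.Night2T3Planes4

/-!
# PercRepro — the CYCLIC-RANK PROFILE of a rank level set, part A: classes, moves, (P1) and (P2)
(night-2 gen 3, NIGHT-2-profile.md §2–§3 — the objects of the profile LP; split from `Night2T3Profile.lean` at the
400-line cap by night-2 gen 4, statements and proofs byte-identical; part B = `Night2T3Profile.lean`)

`Pc M G q k m` = the rank-`q` subsets `S ⊆ G` with `|G ∖ S| = k` and `m(S) = m` (cyclic rank `q − m`);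
`mv M G q k m′ m` = the number of pairs `(S, x)` with `S ∈ Pc (k+1) m′`, `x ∈ G ∖ S` and `m(S ∪ x) = m` (the moves from
class `(k+1, m′)` into class `(k, m)`; `m = m′` is a STAY, `m < m′` a RISE of the cyclic rank).

* `mTr_insert_le_of_mem_Rq`: `m(S ∪ x) ≤ m(S)`; `mTr_le_of_mem_Rq`: `m(G) ≤ m(S)` (the coloops of `G` are coloops of every spanning `S`);
* **(P2)** `succ_mul_card_Pc_eq_sum_mv`: `(k+1)·#Pc (k+1) m′ = Σ_{m(G) ≤ m ≤ m′} mv k m′ m`;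
* **(P1)** `card_mul_card_Pc_eq_sum_mv`: `(|G| − k − m)·#Pc k m = Σ_{m ≤ m′ ≤ q} mv k m′ m` (the down-moves of a set of class
  `(k, m)` are its `|S| − m(S)` non-coloops; `(T, x) ↦ (T ∖ x, x)`).

Imports `Night2T3Absorb` (absorption, decay), `Night2T3Sizes` (`card_filter_eRk_erase_eq`), `Night2T3Tangent`
(`Jq_three_mul_succ_eq`) and `Night2T3Planes4` (the demand-free levels).
-/
namespace PercRepro.Star

open Finset ThmH SixFour GenQ

variable {α : Type*} [DecidableEq α] {M : Matroid α} [M.Finite]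

/-- The profile class `(k, m)`: rank-`q` subsets `S ⊆ G` with `|G ∖ S| = k` and `m(S) = m`. -/
noncomputable def Pc (M : Matroid α) [M.Finite] (G : Finset α) (q k m : ℕ) : Finset (Finset α) :=
  (Rq M G q).filter (fun S : Finset α => (G \ S).card = k ∧ mTr M S = m)

/-- The moves from class `(k+1, m′)` into class `(k, m)`: `Σ_{S ∈ Pc (k+1) m′} #{x ∈ G ∖ S : m(S ∪ x) = m}`. -/
noncomputable def mv (M : Matroid α) [M.Finite] (G : Finset α) (q k m' m : ℕ) : ℕ :=
  ∑ S ∈ Pc M G q (k + 1) m', ((G \ S).filter (fun x => mTr M (insert x S) = m)).card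

/-- Membership in `Pc`: `S ∈ Pc k m ↔ S ∈ R_q(G) ∧ |G ∖ S| = k ∧ m(S) = m`. -/
theorem mem_Pc {G S : Finset α} {q k m : ℕ} :
    S ∈ Pc M G q k m ↔ S ∈ Rq M G q ∧ (G \ S).card = k ∧ mTr M S = m := by
  unfold Pc
  rw [Finset.mem_filter]

/-! ## Two facts about the coloop count along a move -/

/-- Inserting a point of `G` into `S ∈ R_q(G)` keeps `S ∪ x ∈ R_q(G)`. -/
theorem insert_mem_Rq {G S : Finset α} {q : ℕ} (hrG : M.eRk (G : Set α) = (q : ℕ∞)) (hS : S ∈ Rq M G q)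
    {x : α} (hxG : x ∈ G) : insert x S ∈ Rq M G q := by
  have hS' := mem_Rq.1 hS
  have hsub : insert x S ⊆ G := Finset.insert_subset hxG hS'.1
  refine mem_Rq.2 ⟨hsub, le_antisymm ?_ ?_⟩
  · rw [← hrG]
    exact M.eRk_mono (Finset.coe_subset.2 hsub)
  · rw [← hS'.2]
    exact M.eRk_mono (Finset.coe_subset.2 (Finset.subset_insert x S))

/-- `m(S ∪ x) ≤ m(S)` for `S ∈ R_q(G)`, `x ∈ G ∖ S`. -/
theorem mTr_insert_le_of_mem_Rq {G S : Finset α} {q : ℕ} (hG : G ⊆ gr M)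
    (hrG : M.eRk (G : Set α) = (q : ℕ∞)) (hS : S ∈ Rq M G q) {x : α} (hxG : x ∈ G) (hxS : x ∉ S) :
    mTr M (insert x S) ≤ mTr M S := by
  have hS' := mem_Rq.1 hS
  have hr := (mem_Rq.1 (insert_mem_Rq hrG hS hxG)).2
  have hxcl : x ∈ M.closure (S : Set α) := by
    apply mem_closure_of_eRk_insert_le' (hG hxG)
    rw [hr, hS'.2]
  exact Finset.card_le_card (coloopsOf_insert_subset hxS hxcl)

/-- A coloop of `G` is a coloop of every `S ∈ R_q(G)`. -/
theorem coloopsOf_subset_of_mem_Rq {G S : Finset α} {q : ℕ} (hG : G ⊆ gr M)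
    (hrG : M.eRk (G : Set α) = (q : ℕ∞)) (hS : S ∈ Rq M G q) : coloopsOf M G ⊆ coloopsOf M S := by
  intro k hk
  have hS' := mem_Rq.1 hS
  have hk' := mem_coloopsOf.1 hk
  have hkE : k ∈ M.E := by
    rw [← coe_gr M]
    exact Finset.mem_coe.2 (hG hk'.1)
  -- `rk(G ∖ k) + 1 = q`, so `k ∈ S` (else `S ⊆ G ∖ k` has rank `< q`)
  have hstep := eRk_erase_add_one_of_notMem_closure hG hk'.1 hk'.2
  have hkS : k ∈ S := by
    by_contra hkS
    have hsub : S ⊆ G.erase k := fun y hy => Finset.mem_erase.2 ⟨fun h => hkS (h ▸ hy), hS'.1 hy⟩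
    have h1 : M.eRk (S : Set α) ≤ M.eRk ((G.erase k : Finset α) : Set α) := M.eRk_mono (Finset.coe_subset.2 hsub)
    rw [hS'.2] at h1
    rw [hrG] at hstep
    obtain ⟨a, ha⟩ := exists_eRk_eq_nat (M := M) (G.erase k)
    rw [ha] at h1 hstep
    have h1' : q ≤ a := by exact_mod_cast h1
    have h2' : a + 1 = q := by exact_mod_cast hstep
    omega
  rw [mem_coloopsOf]
  refine ⟨hkS, fun hcl => hk'.2 ?_⟩
  exact M.closure_subset_closure (Finset.coe_subset.2 (Finset.erase_subset_erase k hS'.1)) hcl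

/-- `m(G) ≤ m(S)` for `S ∈ R_q(G)`. -/
theorem mTr_le_of_mem_Rq {G S : Finset α} {q : ℕ} (hG : G ⊆ gr M)
    (hrG : M.eRk (G : Set α) = (q : ℕ∞)) (hS : S ∈ Rq M G q) : mTr M G ≤ mTr M S :=
  Finset.card_le_card (coloopsOf_subset_of_mem_Rq hG hrG hS)

/-! ## The up-count (P2) -/

/-- **(P2)**: `(k+1)·#Pc (k+1) m′ = Σ_{m ∈ [m(G), m′]} mv k m′ m`. -/
theorem succ_mul_card_Pc_eq_sum_mv {G : Finset α} {q : ℕ} (hG : G ⊆ gr M)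
    (hrG : M.eRk (G : Set α) = (q : ℕ∞)) (k m' : ℕ) :
    (k + 1) * (Pc M G q (k + 1) m').card = ∑ m ∈ Finset.Icc (mTr M G) m', mv M G q k m' m := by
  unfold mv
  rw [Finset.sum_comm, Finset.card_eq_sum_ones, Finset.mul_sum]
  apply Finset.sum_congr rfl
  intro S hS
  have hS' := mem_Pc.1 hS
  have hfib : (G \ S).card = ∑ m ∈ Finset.Icc (mTr M G) m',
      ((G \ S).filter (fun x => mTr M (insert x S) = m)).card :=
    Finset.card_eq_sum_card_fiberwise (fun x hx => by
      have hx' := Finset.mem_sdiff.1 hx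
      exact Finset.mem_coe.2 (Finset.mem_Icc.2 ⟨mTr_le_of_mem_Rq hG hrG (insert_mem_Rq hrG hS'.1 hx'.1),
        hS'.2.2 ▸ mTr_insert_le_of_mem_Rq hG hrG hS'.1 hx'.1 hx'.2⟩))
  rw [← hfib, hS'.2.1, mul_one]

/-! ## The down-count (P1) -/

/-- For `x ∈ G`: the sets `T ∈ Pc k m` containing `x` with `T ∖ x ∈ Pc (k+1) m′` are in bijection with the sets
`S ∈ Pc (k+1) m′` avoiding `x` with `m(S ∪ x) = m` (`T ↦ T ∖ x`). -/
theorem card_filter_Pc_erase_eq {G : Finset α} {q : ℕ} (hrG : M.eRk (G : Set α) = (q : ℕ∞)) {x : α}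
    (hxG : x ∈ G) (k m m' : ℕ) :
    ((Pc M G q k m).filter (fun T : Finset α => x ∈ T ∧ T.erase x ∈ Pc M G q (k + 1) m')).card =
      ((Pc M G q (k + 1) m').filter (fun S : Finset α => x ∉ S ∧ mTr M (insert x S) = m)).card := by
  refine Finset.card_bij' (fun T _ => T.erase x) (fun S _ => insert x S) ?hi ?hj ?li ?ri
  case hi =>
    intro T hT
    rw [Finset.mem_filter] at hT ⊢
    refine ⟨hT.2.2, Finset.notMem_erase x T, ?_⟩
    rw [Finset.insert_erase hT.2.1]
    exact (mem_Pc.1 hT.1).2.2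
  case hj =>
    intro S hS
    rw [Finset.mem_filter] at hS ⊢
    have hS' := mem_Pc.1 hS.1
    refine ⟨?_, Finset.mem_insert_self x S, ?_⟩
    · rw [mem_Pc]
      refine ⟨insert_mem_Rq hrG hS'.1 hxG, ?_, hS.2.2⟩
      have h1 : G \ S = insert x (G \ insert x S) := by
        ext y
        simp only [Finset.mem_sdiff, Finset.mem_insert]
        constructor
        · rintro ⟨hyG, hyS⟩
          by_cases hyx : y = x
          · exact Or.inl hyx
          · exact Or.inr ⟨hyG, fun h => h.elim (fun h' => hyx h') hyS⟩
        · rintro (rfl | ⟨hyG, hy⟩)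
          · exact ⟨hxG, hS.2.1⟩
          · exact ⟨hyG, fun h => hy (Or.inr h)⟩
      have h2 : x ∉ G \ insert x S := by
        simp only [Finset.mem_sdiff, Finset.mem_insert, true_or, not_true_eq_false, and_false,
          not_false_eq_true]
      have h3 := Finset.card_insert_of_notMem h2
      rw [← h1, hS'.2.1] at h3
      omega
    · rw [Finset.erase_insert hS.2.1]
      exact hS.1
  case li =>
    intro T hT
    exact Finset.insert_erase (Finset.mem_filter.1 hT).2.1
  case ri =>
    intro S hS
    exact Finset.erase_insert (Finset.mem_filter.1 hS).2.1

/-- A set `T ∈ Pc k m` has exactly `|T| − m` points `x` with `T ∖ x ∈ R_q(G)`, each with `T ∖ x ∈ Pc (k+1) m′` for a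
unique `m′ ∈ [m, q]`; so `|T| − m = Σ_{m′ ∈ [m, q]} #{x ∈ T : T ∖ x ∈ Pc (k+1) m′}`. -/
theorem card_sub_mTr_eq_sum_card_filter_erase {G T : Finset α} {q k m : ℕ} (hG : G ⊆ gr M)
    (hrG : M.eRk (G : Set α) = (q : ℕ∞)) (hT : T ∈ Pc M G q k m) :
    T.card - m = ∑ m' ∈ Finset.Icc m q, (T.filter (fun x => T.erase x ∈ Pc M G q (k + 1) m')).card := by
  have hT' := mem_Pc.1 hT
  have hTR := mem_Rq.1 hT'.1
  have hc := card_filter_eRk_erase_eq (hTR.1.trans hG) hTR.2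
  have hcm : T.card - m = (T.filter (fun x => M.eRk ((T.erase x : Finset α) : Set α) = (q : ℕ∞))).card := by
    rw [hc, hT'.2.2]
  rw [hcm]
  -- fiberwise over `m′ = m(T ∖ x)`
  have hfib : (T.filter (fun x => M.eRk ((T.erase x : Finset α) : Set α) = (q : ℕ∞))).card =
      ∑ m' ∈ Finset.Icc m q, ((T.filter (fun x => M.eRk ((T.erase x : Finset α) : Set α) = (q : ℕ∞))).filter
        (fun x => mTr M (T.erase x) = m')).card :=
    Finset.card_eq_sum_card_fiberwise (fun x hx => by
      have hx' := Finset.mem_filter.1 hx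
      have hxR : T.erase x ∈ Rq M G q := mem_Rq.2 ⟨(Finset.erase_subset x T).trans hTR.1, hx'.2⟩
      have h := mTr_insert_le_of_mem_Rq hG hrG hxR (hTR.1 hx'.1) (Finset.notMem_erase x T)
      rw [Finset.insert_erase hx'.1, hT'.2.2] at h
      exact Finset.mem_coe.2 (Finset.mem_Icc.2 ⟨h,
        mTr_le_of_eRk_eq ((Finset.erase_subset x T).trans (hTR.1.trans hG)) hx'.2⟩))
  rw [hfib]
  apply Finset.sum_congr rfl
  intro m' _
  congr 1
  ext x
  simp only [Finset.mem_filter, mem_Pc, mem_Rq]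
  constructor
  · rintro ⟨⟨hxT, hr⟩, hm⟩
    refine ⟨hxT, ⟨(Finset.erase_subset x T).trans hTR.1, hr⟩, ?_, hm⟩
    have h1 : G \ T.erase x = insert x (G \ T) := by
      ext y
      simp only [Finset.mem_sdiff, Finset.mem_erase, Finset.mem_insert, not_and]
      constructor
      · rintro ⟨hyG, h⟩
        by_cases hyx : y = x
        · exact Or.inl hyx
        · exact Or.inr ⟨hyG, h hyx⟩
      · rintro (rfl | ⟨hyG, hyT⟩)
        · exact ⟨hTR.1 hxT, fun h _ => h rfl⟩
        · exact ⟨hyG, fun _ => hyT⟩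
    have h2 : x ∉ G \ T := by
      simp only [Finset.mem_sdiff, not_and, not_not]
      exact fun _ => hxT
    rw [h1, Finset.card_insert_of_notMem h2, hT'.2.1]
  · rintro ⟨hxT, ⟨-, hr⟩, -, hm⟩
    exact ⟨⟨hxT, hr⟩, hm⟩

/-- **(P1)**: `(|G| − k − m)·#Pc k m = Σ_{m′ ∈ [m, q]} mv k m′ m`. -/
theorem card_mul_card_Pc_eq_sum_mv {G : Finset α} {q : ℕ} (hG : G ⊆ gr M)
    (hrG : M.eRk (G : Set α) = (q : ℕ∞)) (k m : ℕ) :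
    (G.card - k - m) * (Pc M G q k m).card = ∑ m' ∈ Finset.Icc m q, mv M G q k m' m := by
  -- left side as `Σ_{T ∈ Pc k m} (|T| − m)`
  have hL : ∑ T ∈ Pc M G q k m, (T.card - m) = (G.card - k - m) * (Pc M G q k m).card := by
    rw [Finset.card_eq_sum_ones (Pc M G q k m), Finset.mul_sum]
    apply Finset.sum_congr rfl
    intro T hT
    have hT' := mem_Pc.1 hT
    have hsub := (mem_Rq.1 hT'.1).1
    have hsd := Finset.card_sdiff_of_subset hsub
    have hle := Finset.card_le_card hsub
    rw [hT'.2.1] at hsd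
    omega
  rw [← hL, Finset.sum_congr rfl (fun T hT => card_sub_mTr_eq_sum_card_filter_erase hG hrG hT), Finset.sum_comm]
  apply Finset.sum_congr rfl
  intro m' _
  unfold mv
  -- both sides as sums over `x ∈ G` of indicator counts
  have e1 : ∀ T ∈ Pc M G q k m, (T.filter (fun x => T.erase x ∈ Pc M G q (k + 1) m')).card =
      ∑ x ∈ G, (if (x ∈ T ∧ T.erase x ∈ Pc M G q (k + 1) m') then 1 else 0) := by
    intro T hT
    have hsub := (mem_Rq.1 (mem_Pc.1 hT).1).1
    rw [Finset.sum_boole, Nat.cast_id]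
    congr 1
    ext x
    simp only [Finset.mem_filter]
    constructor
    · rintro ⟨hxT, h⟩
      exact ⟨hsub hxT, hxT, h⟩
    · rintro ⟨-, hxT, h⟩
      exact ⟨hxT, h⟩
  have e2 : ∀ S ∈ Pc M G q (k + 1) m', ((G \ S).filter (fun x => mTr M (insert x S) = m)).card =
      ∑ x ∈ G, (if (x ∉ S ∧ mTr M (insert x S) = m) then 1 else 0) := by
    intro S _
    rw [Finset.sum_boole, Nat.cast_id]
    congr 1
    ext x
    simp only [Finset.mem_filter, Finset.mem_sdiff, and_assoc]
  rw [Finset.sum_congr rfl e1, Finset.sum_congr rfl e2, Finset.sum_comm]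
  conv_rhs => rw [Finset.sum_comm]
  apply Finset.sum_congr rfl
  intro x hx
  rw [Finset.sum_boole, Finset.sum_boole, Nat.cast_id, Nat.cast_id]
  exact card_filter_Pc_erase_eq hrG hx k m m'

end PercRepro.Star
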